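import Mathlib
import HarnessLib
import Summits.Langlands.Langlands.Statement
import Summits.Langlands.Langlands.Theorems.BaseFieldAscentReciprocityTRCMStubAutToGalCMtoTRCorresponds
import Literature.NumberTheory.Automorphic.ReciprocityGLnRankOneProofs
import Literature.NumberTheory.Automorphic.AlgebraicityParityGL

/-!
# Direction (A), CM ⇒ totally real, WEAK form, every rank `0 < n`
# (crux `ReciprocityTRCM`, stmt-Langlands-1093, line `registered`; `--supports` helper for the registered
# stub `stub_autToGalCMtoTR` = item stmt-Langlands-1063 `LiftDescend.AutToGalCMtoTR`)

Support file (closes nothing).  The registered wrapper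
`ReciprocityTRCM.autToGal_weak_totallyReal_of_CM_of_autToGalCM` (`…StubAutToGalCMtoTRCorresponds`)
derives the WEAK form of the stub's conclusion (an irreducible `ρ : Γ_F → GL_n(ℚ̄_ℓ)` Satake–Frobenius
compatible with `π` a.e.) from the stub's hypothesis verbatim for `2 ≤ n` only, because the converse
matching "local–global compatibility at an unramified `w ∤ ℓ` ⇒ Satake–Frobenius compatibility" feeding
the CM input is a `GL_n`, `n ≥ 2`, statement (genericity, JPSS `L`-factors).  This file closes the
rank-one gap WITHOUT any CM input and without base change: over EVERY number field, an L-algebraic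
cuspidal `π` on `GL₁` is acted on through `χ_π ∘ det` for an algebraic Hecke character `χ_π`
(`exists_heckeCharacter_glOne`, `isAlgebraic_heckeCharacter_glOne_of_isCAlgebraic`, L = C-algebraic in
odd rank), whose `ℓ`-adic character (Weil 1956, `HeckeCharacter.IsAlgebraic.exists_lAdic`) is
Satake–Frobenius compatible with `π` at every unramified `v ∤ ℓ`
(`exists_satakeCompatible_glOne`, the proof of `HarrisLanTaylorThorne2016.theoremA_existence_rank_one`
read in the summit's vocabulary), and a character is irreducible.  Assembly:
`autToGal_weak_totallyReal_of_CM_of_autToGalCM'` — the registered wrapper with `1 < n` relaxed to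
`0 < n`.  Conditional (for `n ≥ 2` only) on the two UNDISCHARGED named facts
`ArthurClozel1989_strongLifting_cuspidal`, `ArthurClozel1989_strongLifting_archimedean` (explicit
hypotheses).  No definitions; standard axioms.

## References
* A. Weil, *On a certain type of characters of the idèle-class group*, Tokyo–Nikko 1955 (1956), §1–§2.
  [Weil1956]
* M. Harris, K.-W. Lan, R. Taylor, J. Thorne, Res. Math. Sci. 3:37 (2016), proof of Thm. 7.13 (p. 232,
  case n = 1) and of Cor. 7.14. [HarrisLanTaylorThorneRMS2016]
* C. M. Sorensen, *A patching lemma*, LMS Lecture Note Ser. 457 (2020), §1, Thm. 1. [Sorensen2020]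
* K. Buzzard, T. Gee, LMS Lecture Note Ser. 414 (2014), §3.1, Conj. 3.2.1. [BuzzardGeeLMS2014]
-/

noncomputable section

set_option linter.dupNamespace false -- project-wide option; `Summit.Langlands.Langlands` is the mandated namespace

open scoped MatrixGroups Matrix NumberField Classical Polynomial
open Filter IsDedekindDomain Field NumberField Polynomial
open Literature.NumberTheory.Automorphic Literature.NumberTheory.GaloisRepresentations
open Summit.Langlands

namespace Summit.Langlands.Langlands.Theorems.ReciprocityTRCM

section RankOne

variable {K : Type} [Field K] [NumberField K] {ℓ : ℕ} [Fact ℓ.Prime]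

omit [NumberField K] in
/-- **Rank one**: every continuous `ρ : Γ_K →ₜ* GL₁(ℚ̄_ℓ)` is irreducible (the lattice of
subrepresentations of a line is `{⊥, ⊤}` with `⊥ ≠ ⊤`). [folklore] -/
private theorem isIrreducible_of_rank_one_trcm (ρ : FramedGaloisRep K (PadicAlgCl ℓ) 1) :
    ρ.toGaloisRep.IsIrreducible := by
  -- adapted from `IrreducibleOffSector.isIrreducible_of_rank_one` (…IrreducibleOffSectorTransfer)
  change IsSimpleOrder (Subrepresentation (FramedRep.toRepresentation ρ))
  haveI hV : IsSimpleOrder (Submodule (PadicAlgCl ℓ) (Fin 1 → PadicAlgCl ℓ)) :=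
    is_simple_module_of_finrank_eq_one (Module.finrank_fin_fun (PadicAlgCl ℓ))
  have hbot : (⊥ : Subrepresentation (FramedRep.toRepresentation ρ)).toSubmodule = ⊥ := rfl
  have htop : (⊤ : Subrepresentation (FramedRep.toRepresentation ρ)).toSubmodule = ⊤ := rfl
  haveI : Nontrivial (Subrepresentation (FramedRep.toRepresentation ρ)) := by
    refine ⟨⟨⊥, ⊤, fun h => ?_⟩⟩
    have h' := congrArg Subrepresentation.toSubmodule h
    rw [hbot, htop] at h'
    exact bot_ne_top h'
  refine ⟨fun W => ?_⟩
  rcases hV.2 W.toSubmodule with h | h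
  · exact Or.inl (Subrepresentation.toSubmodule_injective (h.trans hbot.symm))
  · exact Or.inr (Subrepresentation.toSubmodule_injective (h.trans htop.symm))

/-- **Weak (A) in rank one, over EVERY number field** (Weil 1956; Harris–Lan–Taylor–Thorne, proof of
Thm. 7.13, case `n = 1`): an L-algebraic cuspidal `π` on `GL₁(𝔸_K)` has, for every `ℓ` and `ι`, an
(irreducible) `ρ : Γ_K → GL₁(ℚ̄_ℓ)` Satake–Frobenius compatible with `π` at every place `v ∤ ℓ` where
`π` is unramified, in particular almost everywhere.  `π` is acted on through `χ ∘ det` for a Hecke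
character `χ` (`exists_heckeCharacter_glOne`), algebraic because `π` is C-algebraic (= L-algebraic in
odd rank; `isAlgebraic_heckeCharacter_glOne_of_isCAlgebraic`); `ρ` is Weil's `ℓ`-adic character of `χ`
(`HeckeCharacter.IsAlgebraic.exists_lAdic`): at `v ∤ ℓ` with `π_v` unramified, `χ` is unramified
(`isUnramifiedAt_heckeCharacter_glOne`), the Satake parameter is `{χ(ϖ_v)}`
(`exists_eq_singleton_of_hasSatakeParamAt_glOne`) and `char ρ(Frob_v) = X - ι⁻¹(χ(ϖ_v))⁻¹ =
arithFrobPolyOfSatake ι q_v 1 {χ(ϖ_v)}`. [cite: Weil1956, §1–§2]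
[cite: HarrisLanTaylorThorneRMS2016, proof of Thm. 7.13 (p. 232, case n = 1)] -/
theorem exists_satakeCompatible_glOne (hcpt : isCompact_glFiniteIntegralLevel 1 K)
    (π : CuspidalAutomorphicRepData 1 K hcpt) (hπ : π.1.IsLAlgebraic) (ι : PadicAlgCl ℓ ≃+* ℂ) :
    ∃ ρ : FramedGaloisRep K (PadicAlgCl ℓ) 1, ρ.toGaloisRep.IsIrreducible ∧
      (∀ v : HeightOneSpectrum (𝓞 K), ((ℓ : ℕ) : 𝓞 K) ∉ v.asIdeal → π.1.IsUnramifiedAt v →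
        SatakeFrobCompatibleAt ι π.1 ρ v) ∧
      ∀ᶠ v : HeightOneSpectrum (𝓞 K) in cofinite, SatakeFrobCompatibleAt ι π.1 ρ v := by
  -- adapted from `HarrisLanTaylorThorne2016.theoremA_existence_rank_one` (ReciprocityGLnRankOneProofs)
  classical
  have hℓ : ℓ.Prime := Fact.out
  obtain ⟨χ, hχ⟩ := π.1.exists_heckeCharacter_glOne
  have halg : χ.IsAlgebraic :=
    π.1.isAlgebraic_heckeCharacter_glOne_of_isCAlgebraic hχ (hπ.isCAlgebraic_of_odd odd_one)
  obtain ⟨r, hr⟩ := halg.exists_lAdic ι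
  have hsat : ∀ v : HeightOneSpectrum (𝓞 K), ((ℓ : ℕ) : 𝓞 K) ∉ v.asIdeal → π.1.IsUnramifiedAt v →
      SatakeFrobCompatibleAt ι π.1 r v := by
    rintro v hvℓ ⟨α, hα⟩
    have hur : χ.IsUnramifiedAt v := π.1.isUnramifiedAt_heckeCharacter_glOne hχ hα
    obtain ⟨hunr, hfrob⟩ := hr v hvℓ hur
    refine ⟨α, hα, hunr, ?_⟩
    obtain ⟨ϖ, hϖ, rfl⟩ := π.1.exists_eq_singleton_of_hasSatakeParamAt_glOne hχ hα
    have hc : ((χ (localUnits v ϖ) : ℂˣ) : ℂ) = χ.valueAtUniformizer v := by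
      rw [← HeckeCharacter.localComponent_eq_valueAtUniformizer hur hϖ,
        HeckeCharacter.localComponent_apply]
    rw [arithFrobPolyOfSatake_one, Multiset.map_singleton, Multiset.prod_singleton, hc]
    exact hfrob
  refine ⟨r, isIrreducible_of_rank_one_trcm r, hsat, ?_⟩
  -- almost everywhere: the bad places lie over `ℓ` or among the finitely many ramified places of `π`
  have hcof : {v : HeightOneSpectrum (𝓞 K) | ¬ π.1.IsUnramifiedAt v}.Finite :=
    π.1.hasSatakeParamAt_cofinite_holds
  rw [Filter.eventually_cofinite]
  refine ((finite_setOf_natCast_mem (K := K) hℓ.ne_zero).union hcof).subset fun v hv ↦ ?_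
  simp only [Set.mem_setOf_eq, Set.mem_union] at hv ⊢
  by_contra h
  rw [not_or, not_not] at h
  exact hv (hsat v h.1 h.2)

end RankOne

section Weak

/-- **(A) over all CM fields ⇒ WEAK (A) over all totally real fields, EVERY rank `0 < n`** — the
registered wrapper `autToGal_weak_totallyReal_of_CM_of_autToGalCM` (`2 ≤ n`: CM reciprocity data fed
through `Corresponds` and the converse matching away from `ℓ` into Sorensen patching over the family
`F(√-D)`, granted Arthur–Clozel's strong cuspidal base change `hBC` and its archimedean clause `harch`)
together with the rank-one case `exists_satakeCompatible_glOne` (Weil's `ℓ`-adic character of the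
algebraic Hecke character of `π`; no CM input, no base change).  Conclusion: over every totally real
`F`, every `0 < n`, every L-algebraic cuspidal `π`, `ℓ`, `ι`, an IRREDUCIBLE `ρ : Γ_F → GL_n(ℚ̄_ℓ)`
Satake–Frobenius compatible with `π` almost everywhere.
[cite: Sorensen2020, Thm. 1] [cite: HarrisLanTaylorThorneRMS2016, proof of Thm. 7.13 (p. 232) and Cor. 7.14]
[cite: Weil1956, §1–§2] -/
theorem autToGal_weak_totallyReal_of_CM_of_autToGalCM' :
    Literature.NumberTheory.Automorphic.ArthurClozel1989_strongLifting_cuspidal →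
    Literature.NumberTheory.Automorphic.ArthurClozel1989_strongLifting_archimedean →
    (∀ (F : Type) [Field F] [NumberField F], NumberField.IsCMField F → ∃ R : ReciprocityData F,
      ∀ n : ℕ, 0 < n → ∀ hcpt : Literature.NumberTheory.Automorphic.isCompact_glFiniteIntegralLevel n F,
        AutomorphicToGalois n R hcpt) →
    ∀ (F : Type) [Field F] [NumberField F], NumberField.IsTotallyReal F → ∀ n : ℕ, 0 < n →
      ∀ (hcpt : Literature.NumberTheory.Automorphic.isCompact_glFiniteIntegralLevel n F)
        (π : Literature.NumberTheory.Automorphic.CuspidalAutomorphicRepData n F hcpt), π.1.IsLAlgebraic →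
      ∀ (ℓ : ℕ) [Fact ℓ.Prime] (ι : PadicAlgCl ℓ ≃+* ℂ),
        ∃ ρ : Literature.NumberTheory.GaloisRepresentations.FramedGaloisRep F (PadicAlgCl ℓ) n,
          ρ.toGaloisRep.IsIrreducible ∧
            ∀ᶠ v : IsDedekindDomain.HeightOneSpectrum (NumberField.RingOfIntegers F) in cofinite,
              SatakeFrobCompatibleAt ι π.1 ρ v := by
  intro hBC harch hA F _ _ hF n hn hcpt π hπ ℓ _ ι
  rcases Nat.lt_or_ge 1 n with h1 | h1
  · exact autToGal_weak_totallyReal_of_CM_of_autToGalCM hBC harch hA F hF n h1 hcpt π hπ ℓ ι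
  · obtain rfl : n = 1 := le_antisymm h1 hn
    obtain ⟨ρ, hirr, -, hae⟩ := exists_satakeCompatible_glOne hcpt π hπ ι
    exact ⟨ρ, hirr, hae⟩

end Weak

end Summit.Langlands.Langlands.Theorems.ReciprocityTRCM

end
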